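import Summits.AtomisticToContinuum.Crystallization.Theses.PalmUnimodularRigidity
import Summits.AtomisticToContinuum.Crystallization.Theorems.MinimiserShells.Negative.LoadBearing
import Summits.AtomisticToContinuum.Crystallization.Theorems.MinimiserShells.Negative.Rootedness
import Summits.AtomisticToContinuum.Crystallization.Theorems.PalmUnimodularRigidityMinimiserShellsEquilibriumInLawCluster
import Summits.AtomisticToContinuum.Crystallization.Theorems.PalmUnimodularRigidityMinimiserShellsDeepBadPricingOfShellNoBoundary
import Literature.Probability.Process.PointStationaryLaw
import Literature.MathematicalPhysics.StatisticalMechanics.MuGSC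

/-!
# The qualitative no-boundary shell gap gives the threshold pricing (stub S11, reshape r4)

Stub `stub_thresholdBadPricing_of_qualShellNoBoundary` (S11) of line `equilibrium-in-law-surgery` (reshape r4) of
crux `MinimiserShells` (stmt-AtomisticToContinuum-9225, route `PalmUnimodularRigidity`).

If the QUALITATIVE particle-level no-boundary shell gap holds — for every threshold `t > 0` some `κ > 0` with
`N · (e* + κ) ≤ 𝓔_N(y)` for every finite injective configuration `y : Fin N → ℝ³` having at least `t · N`
badly-shelled sites — then the threshold pricing of deep badly-shelled sites on large cube windows (stub S7″ of
the line) holds with `L₀ = 1`, `R₀ = 2` and the same `κ`, for every `S ⊆ ℝ³` (the separation, `μ`GSC and cube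
hypotheses are not used): in every window `C ⊆ S` whose `R₀`-deep sites badly shelled in `S` number at least
`t · #C`, one has `#C · (e* + κ) ≤ ½ ∑∑_C V_LJ`.

Proof (as S9, `…DeepBadPricingOfShellNoBoundary`).  A `2`-deep site is badly shelled in `S` iff it is badly shelled
in the finite configuration `C` (locality of `GoodShell`, `ShellNoBoundary.card_le_natCard_bad`), so the canonical
enumeration of `C` has at least `#G ≥ t · #C` badly-shelled indices, and its interaction energy is `½ ∑∑_C V_LJ`
(`two_mul_interactionEnergy_equivFin`).
-/

noncomputable section

open MeasureTheory
open scoped ENNReal BigOperators Classical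

namespace Summit.AtomisticToContinuum.Crystallization.Theorems.PalmUnimodularRigidityMinimiserShells.QualShellNoBoundary

open Literature.Probability.Process (IsPointStationaryLaw IsRootedHardCore)
open Literature.MathematicalPhysics.StatisticalMechanics (lennardJones IsMuGSC UniformlyDiscrete interactionEnergy)
open Summit.AtomisticToContinuum.Crystallization.Theses.PalmUnimodularRigidity (MinimiserShells)
open Summit.AtomisticToContinuum.Crystallization.Theorems.MinimiserShells.Negative.LoadBearing
  (eStar meanRootEnergy GoodShell)
open Summit.AtomisticToContinuum.Crystallization.Theorems.MinimiserShells.Negative.Rootedness (E3)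
open Summit.AtomisticToContinuum.Crystallization.Theorems.PalmUnimodularRigidityMinimiserShells.EquilibriumInLaw.Cluster
  (two_mul_interactionEnergy_equivFin)
open Summit.AtomisticToContinuum.Crystallization.Theorems.PalmUnimodularRigidityMinimiserShells.ShellNoBoundary
  (equivFin_symm_val_injective range_equivFin_symm_val card_le_natCard_bad)

/-- **Stub `stub_thresholdBadPricing_of_qualShellNoBoundary` (S11) of line `equilibrium-in-law-surgery`.**  The
qualitative particle-level no-boundary shell gap implies the threshold pricing S7″ (large cube windows of the DLR
class) with `L₀ = 1`, `R₀ = 2` and the same `κ` — in fact for every window of every `S ⊆ ℝ³`. -/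
theorem stub_thresholdBadPricing_of_qualShellNoBoundary :
    (∀ t : ℝ, 0 < t → ∃ κ : ℝ, 0 < κ ∧ ∀ (N : ℕ) (y : Fin N → EuclideanSpace ℝ (Fin 3)), Function.Injective y →
      t * (N : ℝ) ≤ (Nat.card {i : Fin N // ¬ GoodShell
          ((Measure.count : Measure (EuclideanSpace ℝ (Fin 3))).restrict ((fun z => z - y i) '' Set.range y))} : ℝ) →
      (N : ℝ) * (eStar + κ) ≤ interactionEnergy lennardJones y) →
    ∀ δ : ℝ, 0 < δ → ∀ t : ℝ, 0 < t → ∃ L₀ R₀ κ : ℝ, 0 < L₀ ∧ 0 < R₀ ∧ 0 < κ ∧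
      ∀ S : Set (EuclideanSpace ℝ (Fin 3)), (∀ x ∈ S, ∀ z ∈ S, x ≠ z → δ ≤ dist x z) →
        IsMuGSC lennardJones eStar S →
        ∀ L : ℝ, L₀ ≤ L → ∀ a : Fin 3 → ℝ, ∀ C : Finset (EuclideanSpace ℝ (Fin 3)),
          (↑C : Set (EuclideanSpace ℝ (Fin 3))) =
            S ∩ {z : EuclideanSpace ℝ (Fin 3) | ∀ i, a i ≤ z i ∧ z i < a i + L} →
        ∀ G : Finset (EuclideanSpace ℝ (Fin 3)), G ⊆ C →
          (∀ y ∈ G, ¬ GoodShell ((Measure.count : Measure (EuclideanSpace ℝ (Fin 3))).restrict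
              ((fun z => z - y) '' S)) ∧ S ∩ Metric.closedBall y R₀ ⊆ ↑C) →
          t * (C.card : ℝ) ≤ (G.card : ℝ) →
          (C.card : ℝ) * (eStar + κ) ≤ (∑ x ∈ C, ∑ z ∈ C, lennardJones (dist x z)) / 2 := by
  intro hgap δ _ t ht
  obtain ⟨κ, hκ, hgapt⟩ := hgap t ht
  refine ⟨1, 2, κ, one_pos, two_pos, hκ, fun S _ _ L _ a C hC G hGC hG hthr => ?_⟩
  have hCS : (↑C : Set E3) ⊆ S := hC ▸ Set.inter_subset_left
  have h2 := two_mul_interactionEnergy_equivFin C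
  have hle : (G.card : ℝ) ≤ (Nat.card {i : Fin C.card // ¬ GoodShell
      ((Measure.count : Measure E3).restrict ((fun z => z - ((C.equivFin.symm i : C) : E3)) ''
        Set.range (fun i => ((C.equivFin.symm i : C) : E3))))} : ℝ) := by
    exact_mod_cast card_le_natCard_bad hCS (by norm_num : (5 : ℝ) / 4 ≤ 2) hGC hG
      (range_equivFin_symm_val C)
  have hE := hgapt C.card (fun i => ((C.equivFin.symm i : C) : E3)) (equivFin_symm_val_injective C)
    (hthr.trans hle)
  linarith

end Summit.AtomisticToContinuum.Crystallization.Theorems.PalmUnimodularRigidityMinimiserShells.QualShellNoBoundary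

end
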